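import Mathlib.MeasureTheory.Integral.IntervalIntegral.IntegrationByParts
import Summits.QuantumFields.BalabanUV.Beta.EriceFlowEnclosureCesaroHarmonicAverage

/-!
# Beta / EriceFlowEnclosureCesaroHarmonicAtTop — THE RG-TIME AVERAGE IS THE HARMONIC SCALE AVERAGE, LITERALLY: FOR AN AFFINE CLOCK
# y(τ) = cτ + d THE TIME AVERAGE `(1∕(T − T₀))∫_{T₀}^T M(1∕y(τ)) dτ` EQUALS `H_{c′}(t)∕(1 − t∕c′)` AT t = 1∕y(T), c′ = 1∕y(T₀); WITH THE
# TRANSFERS atTop ⟷ 0⁺, THE CESÀRO MEAN AT INFINITY OF A NULL FUNCTION, AND POWER RATES FOR THE HARMONIC AVERAGE (THE EXPONENT HALVES)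
# (pure [folklore] SERVICE for P2 #52i; Mathlib + P2 #52f only)
# (β-flow team, prover 2 = lower ∕ positivity side, unit `b2b-balaban-beta-bflow-p2`, gen 35; module P2 #52h; no Erice sentence occurs)

HONEST FRAMING (page 1 of everything the β sub-cell writes): discharging `BetaPertH` makes Bałaban's UV stability UNCONDITIONAL — a
real constructive-QFT result; it is NOT the continuum limit and NOT the Clay problem.  HONEST DEPENDENCY (cell reorg 2026-08-19,
verbatim): «continuum YM on T⁴ ⇐ BetaPertH ∧ nine spine estimates (0/9 proved); BetaPertH ⇐ (D1) ∧ (D4) ∧ CAP+tail; G-an2-4 gates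
asym, D1 and NE2/3/4.»  THIS MODULE DISCHARGES NOTHING and quotes nothing: [folklore] real analysis — two changes of variables in an
interval integral (affine, and s = 1∕y), two filter transfers, and the Cesàro mean at infinity of a function tending to 0; no β-function occurs.

THE POINT.  P2 #52f READ the RG-time ∕ cutoff average of a letter deviation as the harmonic scale average `H_c(t) = t·∫ₜᶜ M(s)s⁻² ds`; this
file makes the reading an IDENTITY, so that P2 #52i can state the time-average theorem on the running coupling of (3.61) in the kernel:
for `0 < c` (clock slope), `y(τ) = cτ + d`, `T₀ < T` with `y(T₀) ≥ 1∕δ`: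
     **`(1∕(T − T₀))·∫_{T₀}^T F(1∕y(τ)) dτ = (t∕(1 − t∕c′))·∫ₜ^{c′} F(s)s⁻² ds`,  t = 1∕y(T), c′ = 1∕y(T₀)**   (`timeAvg_eq_harmonic`)
for F continuous on ]0, δ] (affine substitution, then s = y⁻¹ with `ds = −y⁻²dy`); `T → ∞ ⟺ y → ∞ ⟺ t → 0⁺` (`tendsto_comp_inv_atTop_iff`,
`tendsto_affine_atTop_iff`); the prefactor `1∕(1 − t∕c′) → 1` is harmless (`tendsto_div_one_sub_iff`); and a remainder tending to 0 in τ has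
time average tending to 0 (`timeAvg_tendsto_zero`).

WHAT THIS FILE PROVES (0 sorry, 0 def): §1 `tendsto_comp_inv_atTop_iff`, `tendsto_affine_atTop_iff`, `tendsto_div_one_sub_iff`; §2
`timeAvg_tendsto_zero`, `timeAvg_abs_le`; §3 `integral_comp_inv_eq`, HEADLINE **`timeAvg_eq_harmonic`**; §4 **`harmonic_power_rate`** (H-rate
`A s^γ` ⟹ `|M t − m| ≤ (4C + 3·2^γA)·t^(γ∕2)` — the exponent halves, the companion of row L112's `power_rate` for P2 #52f's average).
NOT CLAIMED: anything about β-functions or flows (P2 #52i); non-affine clocks; `BetaPertH`; continuum; Clay.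
-/

namespace Summit.QuantumFields.BalabanUV.Beta.EriceFlowEnclosureCesaroHarmonicAtTop

open Set Filter Topology MeasureTheory
open Summit.QuantumFields.BalabanUV.Beta.EriceFlowEnclosureCesaroHigherOrder (const_nonneg)
open Summit.QuantumFields.BalabanUV.Beta.EriceFlowEnclosureCesaroHarmonicAverage (harmonic_rate)

noncomputable section

/-! ## §1 Filter transfers: y → ∞ versus s = 1∕y → 0⁺, affine clocks, a prefactor tending to 1 -/

/-- `F(y⁻¹) → l as y → ∞ ⟺ F(s) → l as s → 0⁺`. [folklore] -/
theorem tendsto_comp_inv_atTop_iff {F : ℝ → ℝ} {l : Filter ℝ} :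
    Tendsto (fun y => F y⁻¹) atTop l ↔ Tendsto F (𝓝[>] 0) l := by
  constructor
  · intro h
    refine (h.comp tendsto_inv_nhdsGT_zero).congr' ?_
    filter_upwards [self_mem_nhdsWithin] with s hs
    simp only [Function.comp_def, inv_inv]
  · intro h
    exact h.comp tendsto_inv_atTop_nhdsGT_zero

/-- `G(cτ + d) → l as τ → ∞ ⟺ G(y) → l as y → ∞` (c > 0). [folklore] -/
theorem tendsto_affine_atTop_iff {G : ℝ → ℝ} {c d : ℝ} {l : Filter ℝ} (hc : 0 < c) :
    Tendsto (fun τ => G (c * τ + d)) atTop l ↔ Tendsto G atTop l := by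
  have hY : Tendsto (fun τ : ℝ => c * τ + d) atTop atTop :=
    tendsto_atTop_add_const_right _ _ (tendsto_id.const_mul_atTop hc)
  have hT : Tendsto (fun y : ℝ => (y - d) / c) atTop atTop := by
    have h1 : Tendsto (fun y : ℝ => c⁻¹ * y + (-d / c)) atTop atTop :=
      tendsto_atTop_add_const_right _ _ (tendsto_id.const_mul_atTop (inv_pos.mpr hc))
    refine h1.congr' (Eventually.of_forall fun y => ?_)
    field_simp
    ring
  constructor
  · intro h
    refine (h.comp hT).congr' (Eventually.of_forall fun y => ?_)
    simp only [Function.comp_def]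
    congr 1
    field_simp
    ring
  · intro h
    exact h.comp hY

/-- A prefactor tending to 1: `H(t)∕(1 − t∕c′) → m at 0⁺ ⟺ H(t) → m at 0⁺` (c′ ≠ 0). [folklore] -/
theorem tendsto_div_one_sub_iff {H : ℝ → ℝ} {c' m : ℝ} (hc' : c' ≠ 0) :
    Tendsto (fun t => H t / (1 - t / c')) (𝓝[>] 0) (𝓝 m) ↔ Tendsto H (𝓝[>] 0) (𝓝 m) := by
  have hden : Tendsto (fun t : ℝ => 1 - t / c') (𝓝[>] 0) (𝓝 1) := by
    have h : Tendsto (fun t : ℝ => 1 - t / c') (𝓝 0) (𝓝 (1 - 0 / c')) :=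
      (continuous_const.sub (continuous_id.div_const _)).tendsto 0
    rw [zero_div, sub_zero] at h
    exact h.mono_left nhdsWithin_le_nhds
  have hne : ∀ᶠ t in 𝓝[>] (0:ℝ), 1 - t / c' ≠ 0 := by
    filter_upwards [Ioo_mem_nhdsGT (show (0:ℝ) < |c'| / 2 by positivity)] with t ht
    intro h0
    have h1 : t = c' := by
      field_simp at h0
      linarith
    rw [h1] at ht
    have := ht.2
    have h2 : |c'| ≤ |c'| / 2 := by
      calc |c'| = c' := abs_of_pos ht.1
        _ ≤ |c'| / 2 := this.le
    linarith [abs_pos.mpr hc']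
  constructor
  · intro h
    have h1 := h.mul hden
    rw [mul_one] at h1
    refine h1.congr' ?_
    filter_upwards [hne] with t ht
    exact div_mul_cancel₀ (H t) ht
  · intro h
    have h1 := h.div hden one_ne_zero
    rwa [div_one] at h1

/-! ## §2 The time average of a remainder tending to 0 tends to 0 -/

/-- **Cesàro at infinity of a null function**: if f is interval-integrable on every [T₀, T] and `f → 0` as τ → ∞ then
`(1∕(T − T₀))∫_{T₀}^T f → 0` as T → ∞. [folklore] -/
theorem timeAvg_tendsto_zero {f : ℝ → ℝ} {T₀ : ℝ}
    (hint : ∀ T, T₀ ≤ T → IntervalIntegrable f volume T₀ T) (hf : Tendsto f atTop (𝓝 0)) :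
    Tendsto (fun T => (∫ τ in T₀..T, f τ) / (T - T₀)) atTop (𝓝 0) := by
  refine Metric.tendsto_nhds.mpr fun ε hε => ?_
  -- beyond T₁ ≥ T₀: |f| ≤ ε/2
  obtain ⟨T₁', hT₁'⟩ := (Metric.tendsto_nhds.mp hf (ε / 2) (by positivity)).exists_forall_of_atTop
  set T₁ : ℝ := max T₀ T₁' with hT₁
  have hT₀₁ : T₀ ≤ T₁ := le_max_left _ _
  have hsmall : ∀ τ, T₁ ≤ τ → |f τ| ≤ ε / 2 := by
    intro τ hτ
    have h := hT₁' τ ((le_max_right _ _).trans hτ)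
    rw [Real.dist_eq, sub_zero] at h
    exact h.le
  set K : ℝ := ∫ τ in T₀..T₁, f τ with hK
  -- for T ≥ T₁: ∫_{T₀}^T f = K + ∫_{T₁}^T f, |∫_{T₁}^T f| ≤ (ε/2)(T − T₁)
  have hbig : ∀ T, T₁ ≤ T → |∫ τ in T₀..T, f τ| ≤ |K| + ε / 2 * (T - T₁) := by
    intro T hT
    have hI1 := hint T₁ hT₀₁
    have hI2 : IntervalIntegrable f volume T₁ T := (hint T₁ hT₀₁).symm.trans (hint T (hT₀₁.trans hT))
    rw [← intervalIntegral.integral_add_adjacent_intervals hI1 hI2]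
    have hb := intervalIntegral.norm_integral_le_of_norm_le_const (a := T₁) (b := T) (C := ε / 2) (f := f)
      fun τ hτ => by
        rw [uIoc_of_le hT] at hτ
        rw [Real.norm_eq_abs]
        exact hsmall τ hτ.1.le
    rw [Real.norm_eq_abs, abs_of_nonneg (sub_nonneg.mpr hT)] at hb
    calc _ ≤ |K| + |∫ τ in T₁..T, f τ| := abs_add_le _ _
      _ ≤ |K| + ε / 2 * (T - T₁) := by linarith
  -- choose T large: T ≥ T₁ + 1 and (|K| + (ε/2)(T₁ − T₀)... simpler: |K|/(T − T₀) < ε/2 when T − T₀ > 2|K|/ε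
  have hev : ∀ᶠ T in atTop, T₁ + 1 ≤ T ∧ T₀ + (2 * |K| + 2) / ε ≤ T := by
    filter_upwards [eventually_ge_atTop (max (T₁ + 1) (T₀ + (2 * |K| + 2) / ε))] with T hT
    exact ⟨(le_max_left _ _).trans hT, (le_max_right _ _).trans hT⟩
  filter_upwards [hev] with T hT
  obtain ⟨hT1, hT2⟩ := hT
  have hTT₁ : T₁ ≤ T := by linarith
  have hpos : 0 < T - T₀ := by linarith
  rw [Real.dist_eq, sub_zero, abs_div, abs_of_pos hpos, div_lt_iff₀ hpos]
  have h := hbig T hTT₁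
  have hK' : |K| < ε / 2 * (T - T₀) := by
    have h1 : (2 * |K| + 2) / ε ≤ T - T₀ := by linarith
    rw [div_le_iff₀ hε] at h1
    nlinarith [abs_nonneg K]
  calc |∫ τ in T₀..T, f τ| ≤ |K| + ε / 2 * (T - T₁) := h
    _ ≤ |K| + ε / 2 * (T - T₀) := by gcongr
    _ < ε / 2 * (T - T₀) + ε / 2 * (T - T₀) := by linarith
    _ = ε * (T - T₀) := by ring

/-- A pointwise-dominated time average: if `|g τ| ≤ f τ` on [T₀, T] (T₀ ≤ T) with f interval-integrable there, then
`|(1∕(T − T₀))∫_{T₀}^T g| ≤ (1∕(T − T₀))∫_{T₀}^T f` (for T > T₀). [folklore] -/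
theorem timeAvg_abs_le {f g : ℝ → ℝ} {T₀ T : ℝ} (hT : T₀ < T)
    (hfi : IntervalIntegrable f volume T₀ T) (hb : ∀ τ ∈ Icc T₀ T, |g τ| ≤ f τ) :
    |(∫ τ in T₀..T, g τ) / (T - T₀)| ≤ (∫ τ in T₀..T, f τ) / (T - T₀) := by
  have hpos : 0 < T - T₀ := sub_pos.mpr hT
  have h := intervalIntegral.norm_integral_le_of_norm_le (μ := volume) (f := g) hT.le
    (Eventually.of_forall fun τ hτ => by rw [Real.norm_eq_abs]; exact hb τ ⟨hτ.1.le, hτ.2⟩) hfi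
  rw [Real.norm_eq_abs] at h
  rw [abs_div, abs_of_pos hpos]
  exact div_le_div_of_nonneg_right h hpos.le

/-! ## §3 The two substitutions: the time average of F(1∕y(τ)) is the harmonic scale average of F -/

/-- **The substitution s = 1∕y**: for F continuous on [Y⁻¹, Y₀⁻¹] (0 < Y₀ ≤ Y),
`∫_{Y₀}^{Y} F(y⁻¹) dy = ∫_{Y⁻¹}^{Y₀⁻¹} F(s)∕s² ds`. [folklore] -/
theorem integral_comp_inv_eq {F : ℝ → ℝ} {Y₀ Y : ℝ} (hY₀ : 0 < Y₀) (hY : Y₀ ≤ Y)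
    (hF : ContinuousOn F (Icc Y⁻¹ Y₀⁻¹)) :
    ∫ y in Y₀..Y, F y⁻¹ = ∫ s in Y⁻¹..Y₀⁻¹, F s / s ^ 2 := by
  have hYpos : 0 < Y := hY₀.trans_le hY
  -- f = inv, f' = −(y²)⁻¹, g s = −F s / s²:  (g ∘ f) y · f′ y = F(y⁻¹)
  have hderiv : ∀ y ∈ uIcc Y₀ Y, HasDerivAt (fun y : ℝ => y⁻¹) (-(y ^ 2)⁻¹) y := by
    intro y hy
    rw [uIcc_of_le hY] at hy
    exact hasDerivAt_inv (hY₀.trans_le hy.1).ne'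
  have hcont' : ContinuousOn (fun y : ℝ => -(y ^ 2)⁻¹) (uIcc Y₀ Y) := by
    rw [uIcc_of_le hY]
    exact ((continuousOn_id.pow 2).inv₀ fun y hy => pow_ne_zero 2 (hY₀.trans_le hy.1).ne').neg
  have himage : (fun y : ℝ => y⁻¹) '' uIcc Y₀ Y ⊆ Icc Y⁻¹ Y₀⁻¹ := by
    rw [uIcc_of_le hY]
    intro s hs
    obtain ⟨y, hy, rfl⟩ := hs
    have hy0 : 0 < y := hY₀.trans_le hy.1
    exact ⟨by rw [inv_le_inv₀ hYpos hy0]; exact hy.2, by rw [inv_le_inv₀ hy0 hY₀]; exact hy.1⟩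
  have hg : ContinuousOn (fun s : ℝ => -(F s / s ^ 2) * 1) ((fun y : ℝ => y⁻¹) '' uIcc Y₀ Y) := by
    refine ContinuousOn.mono ?_ himage
    refine ((hF.div (continuousOn_id.pow 2) fun s hs => ?_).neg).mul continuousOn_const
    exact pow_ne_zero 2 ((inv_pos.mpr hYpos).trans_le hs.1).ne'
  have hsub := intervalIntegral.integral_comp_mul_deriv' (g := fun s : ℝ => -(F s / s ^ 2) * 1) hderiv hcont' hg
  -- left side of hsub is ∫ F(y⁻¹) (pointwise identity for y ≠ 0)
  have hlhs : ∫ y in Y₀..Y, ((fun s : ℝ => -(F s / s ^ 2) * 1) ∘ fun y : ℝ => y⁻¹) y * -(y ^ 2)⁻¹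
      = ∫ y in Y₀..Y, F y⁻¹ := by
    refine intervalIntegral.integral_congr fun y hy => ?_
    rw [uIcc_of_le hY] at hy
    have hy0 : y ≠ 0 := (hY₀.trans_le hy.1).ne'
    simp only [Function.comp_def]
    field_simp
  rw [hlhs] at hsub
  rw [hsub, intervalIntegral.integral_symm]
  rw [← intervalIntegral.integral_neg]
  refine intervalIntegral.integral_congr fun s _ => ?_
  ring

/-- **THE TIME AVERAGE IS THE HARMONIC SCALE AVERAGE (HEADLINE).**  For an affine clock `y(τ) = cτ + d` (c > 0), `T₀ < T` with
`0 < y(T₀)`, and F continuous on `[1∕y(T), 1∕y(T₀)]`: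
**`(∫_{T₀}^T F(1∕y(τ)) dτ)∕(T − T₀) = (t∕(1 − t∕c′))·∫ₜ^{c′} F(s)∕s² ds`** with `t = 1∕y(T)`, `c′ = 1∕y(T₀)` — P2 #52f's `H_{c′}(t)∕(1 − t∕c′)`.
[folklore] -/
theorem timeAvg_eq_harmonic {F : ℝ → ℝ} {c d T₀ T : ℝ} (hc : 0 < c) (hT : T₀ < T) (hy₀ : 0 < c * T₀ + d)
    (hF : ContinuousOn F (Icc (c * T + d)⁻¹ (c * T₀ + d)⁻¹)) :
    (∫ τ in T₀..T, F (c * τ + d)⁻¹) / (T - T₀)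
      = ((c * T + d)⁻¹ / (1 - (c * T + d)⁻¹ / (c * T₀ + d)⁻¹)) * ∫ s in (c * T + d)⁻¹..(c * T₀ + d)⁻¹, F s / s ^ 2 := by
  have hyy : c * T₀ + d ≤ c * T + d := by nlinarith
  have hy : 0 < c * T + d := hy₀.trans_le hyy
  -- affine substitution
  have h1 : ∫ τ in T₀..T, F (c * τ + d)⁻¹ = c⁻¹ * ∫ y in (c * T₀ + d)..(c * T + d), F y⁻¹ := by
    have h := intervalIntegral.integral_comp_mul_add (fun y : ℝ => F y⁻¹) hc.ne' d (a := T₀) (b := T)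
    simpa [smul_eq_mul] using h
  rw [h1, integral_comp_inv_eq hy₀ hyy hF]
  have hne1 : (c * T + d)⁻¹ ≠ 0 := (inv_pos.mpr hy).ne'
  have hne2 : T - T₀ ≠ 0 := (sub_pos.mpr hT).ne'
  have hne3 : c * T + d ≠ 0 := hy.ne'
  have hne4 : c * T₀ + d ≠ 0 := hy₀.ne'
  have hne5 : 1 - (c * T + d)⁻¹ / (c * T₀ + d)⁻¹ ≠ 0 := by
    rw [div_eq_mul_inv, inv_inv]
    intro h0
    have : (c * T + d)⁻¹ * (c * T₀ + d) = 1 := by linarith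
    rw [inv_mul_eq_div, div_eq_one_iff_eq hne3] at this
    nlinarith
  have key : c⁻¹ / (T - T₀) = (c * T + d)⁻¹ / (1 - (c * T + d)⁻¹ / (c * T₀ + d)⁻¹) := by
    rw [div_eq_div_iff (by exact hne2) hne5]
    field_simp
    ring
  rw [← key]
  ring

/-! ## §4 Power rates for the harmonic average: one halving (the companion of row L112's `power_rate`) -/

/-- **POWER RATES FOR THE HARMONIC AVERAGE — THE EXPONENT HALVES**: φ interval-integrable with |φ| ≤ C on ]0, δ], M its Cesàro mean,
`c ≤ δ`, and an H-rate `|s·∫ₛᶜ M σ⁻² dσ − m| ≤ A·s^γ` on ]0, τ] (γ > 0) ⟹ **`|M t − m| ≤ (4C + 3·2^γ·A)·t^(γ∕2)`** on ]0, min 1 (τ∕2) (c∕2)]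
(P2 #52f `harmonic_rate` with the window q = 1 + t^(γ∕2) and the uniform rate A(2t)^γ on ]0, 2t]; `log(1 + h) ≤ h`). [folklore] -/
theorem harmonic_power_rate {φ : ℝ → ℝ} {δ C : ℝ} (hδ : 0 < δ) (hint : ∀ t ∈ Ioc 0 δ, IntervalIntegrable φ volume 0 t)
    (hb : ∀ v ∈ Ioc 0 δ, |φ v| ≤ C) {c τ A γ m : ℝ} (hc : c ≤ δ) (hA : 0 ≤ A) (hγ : 0 < γ)
    (hE : ∀ s ∈ Ioc 0 τ, |s * (∫ σ in s..c, (∫ v in (0:ℝ)..σ, φ v) / σ / σ ^ 2) - m| ≤ A * s ^ γ) :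
    ∀ t ∈ Ioc 0 (min 1 (min (τ / 2) (c / 2))), |(∫ v in (0:ℝ)..t, φ v) / t - m| ≤ (4 * C + 3 * 2 ^ γ * A) * t ^ (γ / 2) := by
  intro t ht
  have hC := const_nonneg hδ hb
  have ht0 : 0 < t := ht.1
  have ht1 : t ≤ 1 := ht.2.trans (min_le_left _ _)
  have htτ : t ≤ τ / 2 := ht.2.trans ((min_le_right _ _).trans (min_le_left _ _))
  have htc : t ≤ c / 2 := ht.2.trans ((min_le_right _ _).trans (min_le_right _ _))
  set h : ℝ := t ^ (γ / 2) with hh_def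
  have hh0 : 0 < h := Real.rpow_pos_of_pos ht0 _
  have hh1 : h ≤ 1 := Real.rpow_le_one ht0.le ht1 (by positivity)
  have hq : 1 < 1 + h := by linarith
  have hwin : (1 + h) * t ≤ 2 * t := by nlinarith
  -- uniform H-rate on ]0, 2t]
  have hE' : ∀ s ∈ Ioc 0 (2 * t), |s * (∫ σ in s..c, (∫ v in (0:ℝ)..σ, φ v) / σ / σ ^ 2) - m| ≤ A * (2 * t) ^ γ := by
    intro s hs
    have hsτ : s ∈ Ioc 0 τ := ⟨hs.1, hs.2.trans (by linarith)⟩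
    calc _ ≤ A * s ^ γ := hE s hsτ
      _ ≤ A * (2 * t) ^ γ := mul_le_mul_of_nonneg_left (Real.rpow_le_rpow hs.1.le hs.2 hγ.le) hA
  have hrate := harmonic_rate hδ hint hb hc hE' ht0 hq (hwin.trans le_rfl) (hwin.trans (by linarith))
  -- bookkeeping
  have hlog : Real.log (1 + h) ≤ h := by
    have := Real.log_le_sub_one_of_pos (by linarith : (0:ℝ) < 1 + h); linarith
  have h2γ : (2 * t) ^ γ = 2 ^ γ * t ^ γ := Real.mul_rpow (by norm_num) ht0.le
  have htγh : t ^ γ / h = h := by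
    rw [hh_def, ← Real.rpow_sub ht0]
    congr 1
    ring
  have h2pos : 0 < (2:ℝ) ^ γ := Real.rpow_pos_of_pos (by norm_num) _
  have e1 : (1 + h + 1) * (A * (2 * t) ^ γ) / (1 + h - 1) = (2 + h) * (2 ^ γ * A) * h := by
    rw [h2γ, show (1:ℝ) + h - 1 = h by ring, show (1:ℝ) + h + 1 = 2 + h by ring]
    calc (2 + h) * (A * (2 ^ γ * t ^ γ)) / h = (2 + h) * (2 ^ γ * A) * (t ^ γ / h) := by ring
      _ = (2 + h) * (2 ^ γ * A) * h := by rw [htγh]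
  have h1 : 2 * C * (1 + h) * Real.log (1 + h) ≤ 4 * C * h := by
    calc _ ≤ 2 * C * (1 + h) * h := mul_le_mul_of_nonneg_left hlog (by positivity)
      _ = (1 + h) * (2 * C * h) := by ring
      _ ≤ 2 * (2 * C * h) := mul_le_mul_of_nonneg_right (by linarith) (by positivity)
      _ = 4 * C * h := by ring
  have h2 : (2 + h) * (2 ^ γ * A) * h ≤ 3 * 2 ^ γ * A * h := by
    have : (2 + h) * (2 ^ γ * A) ≤ 3 * (2 ^ γ * A) := mul_le_mul_of_nonneg_right (by linarith) (by positivity)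
    calc _ ≤ 3 * (2 ^ γ * A) * h := mul_le_mul_of_nonneg_right this hh0.le
      _ = _ := by ring
  calc _ ≤ 2 * C * (1 + h) * Real.log (1 + h) + (1 + h + 1) * (A * (2 * t) ^ γ) / (1 + h - 1) := hrate
    _ = 2 * C * (1 + h) * Real.log (1 + h) + (2 + h) * (2 ^ γ * A) * h := by rw [e1]
    _ ≤ 4 * C * h + 3 * 2 ^ γ * A * h := add_le_add h1 h2
    _ = (4 * C + 3 * 2 ^ γ * A) * h := by ring

end

end Summit.QuantumFields.BalabanUV.Beta.EriceFlowEnclosureCesaroHarmonicAtTop
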